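import Summits.CriticalPhenomena.PercolationContinuityZ3.Theorems.Transplant.SkelPhiInfClusterMeetsEq
import Summits.CriticalPhenomena.PercolationContinuityZ3.Theorems.Transplant.SkelPhiEquilibriumRegions
import Summits.CriticalPhenomena.PercolationContinuityZ3.Theorems.Transplant.SkelPhiEquilibriumSplit
import Literature.Probability.Percolation.InequalitiesProofs
import HarnessLib

/-!
# (S3) LEVEL 0 for the frames-only node, part 1/2: THE SLIDING-SPLIT LEMMA's INGREDIENTS — slid strips and line events, (L1) monotonicity in the slide,
# (L2) the cover on `SeedPerc`, (L3) the anchors (part 2, `SkelPhiSlideSplitBoth`: (L4) `exists_slide_bothLines`, (L5)/(L6) `exists_slide_sidePieces`)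

builds on p205010 (kernel theorem, internal audit signed; external expert review pending) — nothing in this file uses p205010; NOTHING is claimed about the
frames-only node `SamePDropOfSkeletonFrm₁` (OPEN); the N1 / D″ / Conc / product sentences of record (VERDICTS V124 / V110 / V101 / V79) are unchanged;
Martineau–Tassion 2017 is the SOURCE of every device used here (the exit argument of Facts 1–2, the discrete split of Lemma 3.3, the square-root trick).
Lane `prim-bschramm`, seat `prim-bschramm-stmt` (gen 18; typer); design memo HOME/N2-SCOPE.md (v2/v3, (S3) = design of record, p3 lineage 15:14Z), typer's memo
HOME/prim-bschramm-stmt-g18/W1-SLIDING-SPLIT.md, refuter's sieve B7 (p5-g13 15:12Z: NO KILL, (L1)–(L4) re-derived); helper file (`--supports stmt-CriticalPhenomena-4575 --as helper`).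

WHAT IT REPLACES. N1's LEVEL 0 (`Skelφ.Eq.exists_equilibriumW`, SkelPhiEquilibrium :181) certifies BOTH vertical sides of Martineau–Tassion's box only through the
central inversion `ρ` (:259–:265). Here the side family is certified with NO symmetry: instead of balancing in the height, SLIDE the strip. For a finite seed
`SEED ⊆ {|α| ≤ M}` with `P(SeedPerc SEED) ≥ 1 − δ` and the slid strips `Σ_s = {s − n ≤ α ≤ s + n}`, `|s| ≤ n − M − 1`:
* (L1) `evLine_left_mono` / `evLine_right_mono` — reaching the left line is monotone ↑ in the slide, the right line ↓ (first visit of the nearer line, `Lip`);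
* (L2) `seedPerc_subset_evLine_union_ae` — on `SeedPerc` the seed reaches the left line of `Σ_s` or the right line of `Σ_{s+1}` (first exit of the infinite cluster's
  path from the narrow strip; `MeetsAS` of its complement = `Skelφ.meetsAS_of_farBoxes` on a half-plane, `meetsAS_compl_slabS`);
* (L3) `eventually_evLine_leftAnchor` / `…rightAnchor` — the line adjacent to the seed column is reached for all large `n` (monotone convergence to a half-plane);
* (L4) `real_ge_of_cover` (Harris on the complements) and **`exists_slide_bothLines`**: `∃ n₀, ∀ n ≥ n₀, ∃ s, |s| ≤ n − M − 1 ∧ P(SEED ↔ left line in Σ_s) ≥ 1 − √(2δ) ∧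
  P(SEED ↔ right line in Σ_s) ≥ 1 − √(2δ)`;
* (L5) at the slid BASE VERTEX `tc`, `φ tc = φ t + (s, 0)` (`exists_base_relCoord`, Steps only; `slabS_eq_strip`, `evLine_eq_evSide`): localisation in height
  `evSide_eq_iUnion` / `exists_height_of_evSide`; (L6) the tree's `exists_split_side` at base `tc`, verbatim; assembled as **`exists_slide_sidePieces`**: the FOUR side
  sub-segments of the rectangle `C_tc(n, 0, ℓ)`, split per side at its own drift height, each linked from the seed inside the rectangle w.p. `≥ 1 − √(2√(2δ))`.
Hypotheses throughout: `G.Preconnected`, `Frames`, `Steps`, `Lip`, a.s. uniqueness at `p`, the seed bound — NO `neg`, NO Φ2, NO equilibrium height. The re-centring to one sheared box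
with independent split offsets (`EquilibriumAtW2S`, hp-8 / p3 lineages) and the one-signed slanted family are typed elsewhere.
[cite: MartineauTassion2017, §3.1 Lemma 3.4; §3.2 Lemma 3.3, Lemma 3.5, Fact 2 (arXiv pp. 8–11)] [cite: GrimmettPercolation1999, §11 (11.14) (square-root trick)]
-/
noncomputable section

namespace Summit.CriticalPhenomena.PercolationContinuityZ3.Theorems.Transplant

namespace Skelφ

namespace Eq

open MeasureTheory ProbabilityTheory Filter Topology Literature.Probability.Percolation Literature.Probability.LatticeModels SimpleGraph
open scoped Classical

variable {V : Type} {G : SimpleGraph V} (φ : V → Site 2) (t : V)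

/-! ## §1 Slid strips and the line events -/

/-- The SLID STRIP `{a ≤ α ≤ b}` (all fibres, all heights), `α = (φ w − φ t)₀`. [cite: MartineauTassion2017, §3.2 (Y)] -/
def slabS (a b : ℤ) : Set V := {w | a ≤ relCoord φ t 0 w ∧ relCoord φ t 0 w ≤ b}

/-- Membership in a slid strip. [folklore] -/
@[simp] theorem mem_slabS {a b : ℤ} {w : V} : w ∈ slabS φ t a b ↔ a ≤ relCoord φ t 0 w ∧ relCoord φ t 0 w ≤ b := Iff.rfl

/-- `SEED ↔ {α = c}` INSIDE the slid strip `{a ≤ α ≤ b}`. [cite: MartineauTassion2017, §3.1 (L(a,b))] -/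
def evLine (SEED : Set V) (a b c : ℤ) : Set (BondConfig V) :=
  openCrossing (slabS φ t a b) SEED {w | w ∈ slabS φ t a b ∧ relCoord φ t 0 w = c}

/-- The line events are increasing. [folklore] -/
theorem isUpperSet_evLine (SEED : Set V) (a b c : ℤ) : IsUpperSet (evLine φ t SEED a b c) := isUpperSet_openCrossing _ _ _

/-- The line events are measurable. [folklore] -/
theorem measurableSet_evLine [Countable V] (SEED : Set V) (a b c : ℤ) : MeasurableSet (evLine φ t SEED a b c) :=
  IsoradialArmExtension.measurableSet_openCrossing' _ _ _

variable {φ t}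

/-- Adjacent vertices differ by at most one in `α`. [folklore] -/
theorem abs_relCoord_sub_le_one (hlip : Lip G φ) {z u : V} (h : G.Adj z u) : |relCoord φ t 0 z - relCoord φ t 0 u| ≤ 1 := by
  have h1 := hlip h 0
  simp only [relCoord_apply]
  have e : φ z 0 - φ t 0 - (φ u 0 - φ t 0) = φ z 0 - φ u 0 := by ring
  rw [e]; exact h1

/-- Chaining an open path inside `S` with an open edge whose far end lies in `S`. [folklore] -/
theorem openConnIn_snoc {S : Set V} {x z u : V} {ω : BondConfig V} (h : ω ∈ openConnIn S x z) (hu : u ∈ S) (hzu : (openGraph ω).Adj z u) :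
    ω ∈ openConnIn S x u := by
  obtain ⟨hx, hz, hr⟩ := h
  exact ⟨hx, hu, hr.trans (SimpleGraph.Adj.reachable (show ((openGraph ω).induce S).Adj ⟨z, hz⟩ ⟨u, hu⟩ from hzu))⟩

/-! ## §2 (L1) Monotonicity in the slide: truncate at the first visit of the nearer line -/

/-- **(L1, left)**: reaching the left line `a` inside `[a, b]` implies reaching the left line `a′ ≥ a` inside `[a′, b′]` (`b ≤ b′`) when the seed lies in `{α ≥ a′}`
(lattice configurations). [cite: MartineauTassion2017, §3.1 Lemma 3.1] -/
theorem evLine_left_mono (hlip : Lip G φ) {ω : BondConfig V} (hω : ω ⊆ G.edgeSet) {SEED : Set V} {a a' b b' : ℤ} (haa' : a ≤ a') (hbb' : b ≤ b')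
    (hSa : ∀ x ∈ SEED, a' ≤ relCoord φ t 0 x) (h : ω ∈ evLine φ t SEED a b a) : ω ∈ evLine φ t SEED a' b' a' := by
  obtain ⟨x, hx, y, hyB, hconn⟩ := h
  have hyS : y ∈ slabS φ t a b := hyB.1
  have hyc : relCoord φ t 0 y = a := hyB.2
  obtain ⟨hxab, -, -⟩ := id hconn
  have hsub : slabS φ t a' b ⊆ slabS φ t a' b' := fun w hw => ⟨hw.1, hw.2.trans hbb'⟩
  rcases eq_or_lt_of_le haa' with rfl | hlt
  · have hyB' : y ∈ {w | w ∈ slabS φ t a b' ∧ relCoord φ t 0 w = a} := ⟨hsub hyS, hyc⟩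
    exact ⟨x, hx, y, hyB', openConnIn_mono hsub x y hconn⟩
  · have hxS : x ∈ slabS φ t a' b := ⟨hSa x hx, hxab.2⟩
    have hyS' : y ∉ slabS φ t a' b := fun h' => by have := h'.1; rw [hyc] at this; omega
    obtain ⟨z, hz, u, hu, huS, hzu, hxz⟩ := TwoAxis.exists_exit_of_openConnIn (S := slabS φ t a' b) hxS hyS' hconn
    have hu' : relCoord φ t 0 u < a' := by
      by_contra hge
      exact huS ⟨not_lt.1 hge, hu.2⟩
    have hadj : G.Adj z u := hω ((openGraph_adj ω z u).1 hzu).1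
    have h1 := abs_le.1 (abs_relCoord_sub_le_one (t := t) hlip hadj)
    have hzc : relCoord φ t 0 z = a' := le_antisymm (by linarith [h1.2]) hz.1
    have hzB : z ∈ {w | w ∈ slabS φ t a' b' ∧ relCoord φ t 0 w = a'} := ⟨hsub hz, hzc⟩
    exact ⟨x, hx, z, hzB, openConnIn_mono hsub x z hxz⟩

/-- **(L1, right)**: reaching the right line `b` inside `[a, b]` implies reaching the right line `b′ ≤ b` inside `[a′, b′]` (`a′ ≤ a`) when the seed lies in `{α ≤ b′}`
(lattice configurations). [cite: MartineauTassion2017, §3.1 Lemma 3.1] -/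
theorem evLine_right_mono (hlip : Lip G φ) {ω : BondConfig V} (hω : ω ⊆ G.edgeSet) {SEED : Set V} {a a' b b' : ℤ} (haa' : a' ≤ a) (hbb' : b' ≤ b)
    (hSb : ∀ x ∈ SEED, relCoord φ t 0 x ≤ b') (h : ω ∈ evLine φ t SEED a b b) : ω ∈ evLine φ t SEED a' b' b' := by
  obtain ⟨x, hx, y, hyB, hconn⟩ := h
  have hyS : y ∈ slabS φ t a b := hyB.1
  have hyc : relCoord φ t 0 y = b := hyB.2
  obtain ⟨hxab, -, -⟩ := id hconn
  have hsub : slabS φ t a b' ⊆ slabS φ t a' b' := fun w hw => ⟨haa'.trans hw.1, hw.2⟩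
  rcases eq_or_lt_of_le hbb' with rfl | hlt
  · have hyB' : y ∈ {w | w ∈ slabS φ t a' b' ∧ relCoord φ t 0 w = b'} := ⟨hsub hyS, hyc⟩
    exact ⟨x, hx, y, hyB', openConnIn_mono hsub x y hconn⟩
  · have hxS : x ∈ slabS φ t a b' := ⟨hxab.1, hSb x hx⟩
    have hyS' : y ∉ slabS φ t a b' := fun h' => by have := h'.2; rw [hyc] at this; omega
    obtain ⟨z, hz, u, hu, huS, hzu, hxz⟩ := TwoAxis.exists_exit_of_openConnIn (S := slabS φ t a b') hxS hyS' hconn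
    have hu' : b' < relCoord φ t 0 u := by
      by_contra hge
      exact huS ⟨hu.1, not_lt.1 hge⟩
    have hadj : G.Adj z u := hω ((openGraph_adj ω z u).1 hzu).1
    have h1 := abs_le.1 (abs_relCoord_sub_le_one (t := t) hlip hadj)
    have hzc : relCoord φ t 0 z = b' := le_antisymm hz.2 (by linarith [h1.1])
    have hzB : z ∈ {w | w ∈ slabS φ t a' b' ∧ relCoord φ t 0 w = b'} := ⟨hsub hz, hzc⟩
    exact ⟨x, hx, z, hzB, openConnIn_mono hsub x z hxz⟩

/-! ## §3 (L2) The cover: on `SeedPerc` the seed's infinite cluster leaves the narrow strip through one of the two lines -/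

/-- **(L2)**: a.s. on `SeedPerc SEED`, with `SEED ⊆ {a+1 ≤ α ≤ b−1}`: the seed reaches the line `a` inside `[a, b−1]` or the line `b` inside `[a+1, b]`
(first exit of the infinite cluster's path from the narrow strip; `MeetsAS` of its complement). [cite: MartineauTassion2017, §3.2 Fact 2 (the exit argument)] -/
theorem seedPerc_subset_evLine_union_ae [Countable V] (hlip : Lip G φ) (p : unitInterval) {SEED : Finset V} {a b : ℤ}
    (hS : ∀ x ∈ SEED, a + 1 ≤ relCoord φ t 0 x ∧ relCoord φ t 0 x ≤ b - 1) (hQ : MeetsAS G p (slabS φ t (a + 1) (b - 1))ᶜ) :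
    ∀ᵐ ω ∂bondPercolation G p, ω ∈ TwoAxis.SeedPerc (↑SEED : Set V) →
      ω ∈ evLine φ t ↑SEED a (b - 1) a ∪ evLine φ t ↑SEED (a + 1) b b := by
  have hae : ∀ᵐ ω ∂bondPercolation G p, ω ⊆ G.edgeSet := setBernoulli_ae_subset
  filter_upwards [hae, hQ] with ω hω hωQ hin
  obtain ⟨x, hx, hperc⟩ := hin
  obtain ⟨y, hyQ, hreach⟩ := hωQ x hperc
  have hx' := hS x (Finset.mem_coe.1 hx)
  have hxS : x ∈ slabS φ t (a + 1) (b - 1) := hx'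
  obtain ⟨z, hz, u, -, huS, hzu, hxz⟩ :=
    TwoAxis.exists_exit_of_openConnIn (S := slabS φ t (a + 1) (b - 1)) hxS hyQ (openConnIn_univ_of_reachable hreach)
  have hadj : G.Adj z u := hω ((openGraph_adj ω z u).1 hzu).1
  have h1 := abs_le.1 (abs_relCoord_sub_le_one (t := t) hlip hadj)
  rw [mem_slabS, not_and_or, not_le, not_le] at huS
  have hz1 := hz.1
  have hz2 := hz.2
  rcases huS with hlo | hhi
  · -- exit to the left: `u` is ON the line `a`
    have huc : relCoord φ t 0 u = a := by omega
    have huS' : u ∈ slabS φ t a (b - 1) := ⟨by omega, by omega⟩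
    have huB : u ∈ {w | w ∈ slabS φ t a (b - 1) ∧ relCoord φ t 0 w = a} := ⟨huS', huc⟩
    have hsub : slabS φ t (a + 1) (b - 1) ⊆ slabS φ t a (b - 1) := fun w hw => ⟨by linarith [hw.1], hw.2⟩
    left
    exact ⟨x, hx, u, huB, openConnIn_snoc (openConnIn_mono hsub x z hxz) huS' hzu⟩
  · -- exit to the right: `u` is ON the line `b`
    have huc : relCoord φ t 0 u = b := by omega
    have huS' : u ∈ slabS φ t (a + 1) b := ⟨by omega, by omega⟩
    have huB : u ∈ {w | w ∈ slabS φ t (a + 1) b ∧ relCoord φ t 0 w = b} := ⟨huS', huc⟩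
    have hsub : slabS φ t (a + 1) (b - 1) ⊆ slabS φ t (a + 1) b := fun w hw => ⟨hw.1, by linarith [hw.2]⟩
    right
    exact ⟨x, hx, u, huB, openConnIn_snoc (openConnIn_mono hsub x z hxz) huS' hzu⟩

/-- `MeetsAS` for the complement of every slid strip (it contains the far half-plane `{b + 1 ≤ α}`). [cite: MartineauTassion2017, §3.1 Lemma 3.4] -/
theorem meetsAS_compl_slabS [Countable V] {types : Finset V} (hc : G.Preconnected) (hfr : Frames G φ types) (hstep : Steps G φ) (hlip : Lip G φ)
    {p : unitInterval} (hU : ∀ᵐ ω ∂bondPercolation G p, numInfiniteClusters ω ≤ 1) (a b : ℤ) : MeetsAS G p (slabS φ t a b)ᶜ := by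
  refine Skelφ.meetsAS_of_farBoxes hc hfr hstep hlip t hU ((farBoxes_halfPlane t 0 1 (b + 1)).mono fun w hw hws => ?_)
  rw [mem_halfPlane, Units.val_one, one_mul] at hw
  exact absurd hws.2 (by omega)

/-! ## §4 (L3) The anchors: the line ADJACENT to the seed's column is reached, for large `n` -/

/-- **(L3, left anchor)**: `P(SEED ↔ {α = −(M+1)} inside [−(M+1), 2n−M−1]) > 1 − 2δ` for all large `n`, if `P(SeedPerc SEED) ≥ 1 − δ` and `SEED ⊆ {|α| ≤ M}`
(the strips exhaust the half-plane `{α ≥ −(M+1)}`, which the infinite cluster leaves; monotone convergence). [cite: MartineauTassion2017, §3.2 Fact 2] -/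
theorem eventually_evLine_leftAnchor [Countable V] {types : Finset V} (hc : G.Preconnected) (hfr : Frames G φ types) (hstep : Steps G φ) (hlip : Lip G φ)
    {p : unitInterval} (hU : ∀ᵐ ω ∂bondPercolation G p, numInfiniteClusters ω ≤ 1) {M : ℕ} (SEED : Finset V)
    (hSM : ∀ x ∈ SEED, |relCoord φ t 0 x| ≤ M) {δ : ℝ} (hδ0 : 0 < δ) (hseed : 1 - δ ≤ (bondPercolation G p).real (TwoAxis.SeedPerc (↑SEED : Set V))) :
    ∃ n₁ : ℕ, ∀ n : ℕ, n₁ ≤ n → 1 - 2 * δ < (bondPercolation G p).real (evLine φ t ↑SEED (-((M : ℤ) + 1)) (2 * (n : ℤ) - M - 1) (-((M : ℤ) + 1))) := by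
  set μ := bondPercolation G p with hμ
  set U : ℕ → Set (BondConfig V) := fun n => evLine φ t ↑SEED (-((M : ℤ) + 1)) (2 * (n : ℤ) - M - 1) (-((M : ℤ) + 1)) with hUdef
  have hUmono : Monotone U := by
    intro n n' hnn'
    refine openCrossing_mono (fun w hw => ⟨hw.1, ?_⟩) le_rfl (fun w hw => ⟨⟨hw.1.1, ?_⟩, hw.2⟩)
    · have := hw.2; omega
    · have := hw.1.2; omega
  have hUlim : Tendsto (fun n => μ (U n)) atTop (𝓝 (μ (⋃ n, U n))) := tendsto_measure_iUnion_atTop hUmono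
  -- the half-plane `{−(M+1) ≤ α}` is the increasing union of the strips
  have hQ : MeetsAS G p (halfPlane φ t 0 (-1) ((M : ℤ) + 2)) :=
    Skelφ.meetsAS_of_farBoxes hc hfr hstep hlip t hU (farBoxes_halfPlane t 0 (-1) ((M : ℤ) + 2))
  have hae : ∀ᵐ ω ∂μ, ω ⊆ G.edgeSet := setBernoulli_ae_subset
  have hcover : ∀ᵐ ω ∂μ, ω ∈ TwoAxis.SeedPerc (↑SEED : Set V) → ω ∈ ⋃ n, U n := by
    filter_upwards [hae, hQ] with ω hω hωQ hin
    obtain ⟨x, hx, hperc⟩ := hin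
    obtain ⟨y, hyQ, hreach⟩ := hωQ x hperc
    have hxM := abs_le.1 (hSM x (Finset.mem_coe.1 hx))
    have hxS : x ∈ {w : V | -(M : ℤ) ≤ relCoord φ t 0 w} := hxM.1
    have hyS : y ∉ {w : V | -(M : ℤ) ≤ relCoord φ t 0 w} := by
      intro h'
      rw [mem_halfPlane, Units.val_neg, Units.val_one, neg_mul, one_mul] at hyQ
      have h'' : -(M : ℤ) ≤ relCoord φ t 0 y := h'
      omega
    obtain ⟨z, hz, u, -, huS, hzu, hxz⟩ :=
      TwoAxis.exists_exit_of_openConnIn (S := {w : V | -(M : ℤ) ≤ relCoord φ t 0 w}) hxS hyS (openConnIn_univ_of_reachable hreach)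
    have hadj : G.Adj z u := hω ((openGraph_adj ω z u).1 hzu).1
    have h1 := abs_le.1 (abs_relCoord_sub_le_one (t := t) hlip hadj)
    have hz' : -(M : ℤ) ≤ relCoord φ t 0 z := hz
    have huS' : ¬ (-(M : ℤ) ≤ relCoord φ t 0 u) := huS
    have huc : relCoord φ t 0 u = -((M : ℤ) + 1) := by omega
    -- the path `x → z → u` lies in the half-plane `{−(M+1) ≤ α}` = ⋃ₙ slabS (−(M+1)) (2n − M − 1)
    have hTmono : Monotone (fun n : ℕ => slabS φ t (-((M : ℤ) + 1)) (2 * (n : ℤ) - M - 1)) := by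
      intro n n' hnn' w hw
      exact ⟨hw.1, by have := hw.2; omega⟩
    have hHT : {w : V | -((M : ℤ) + 1) ≤ relCoord φ t 0 w} ⊆ ⋃ n : ℕ, slabS φ t (-((M : ℤ) + 1)) (2 * (n : ℤ) - M - 1) := by
      intro w hw
      have hw' : -((M : ℤ) + 1) ≤ relCoord φ t 0 w := hw
      refine Set.mem_iUnion.2 ⟨(relCoord φ t 0 w + M + 1).toNat, ⟨hw', ?_⟩⟩
      have := Int.self_le_toNat (relCoord φ t 0 w + M + 1)
      omega
    have hsub : {w : V | -(M : ℤ) ≤ relCoord φ t 0 w} ⊆ {w : V | -((M : ℤ) + 1) ≤ relCoord φ t 0 w} := by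
      intro w hw
      have hw' : -(M : ℤ) ≤ relCoord φ t 0 w := hw
      show -((M : ℤ) + 1) ≤ relCoord φ t 0 w
      omega
    have huH : u ∈ {w : V | -((M : ℤ) + 1) ≤ relCoord φ t 0 w} := by
      show -((M : ℤ) + 1) ≤ relCoord φ t 0 u
      omega
    have hpath : ω ∈ openConnIn (⋃ n : ℕ, slabS φ t (-((M : ℤ) + 1)) (2 * (n : ℤ) - M - 1)) x u :=
      openConnIn_mono hHT x u (openConnIn_snoc (openConnIn_mono hsub x z hxz) huH hzu)
    obtain ⟨k, hk⟩ := exists_openConnIn_of_iUnion hTmono hpath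
    obtain ⟨-, huT, -⟩ := id hk
    have huB : u ∈ {w | w ∈ slabS φ t (-((M : ℤ) + 1)) (2 * (k : ℤ) - M - 1) ∧ relCoord φ t 0 w = -((M : ℤ) + 1)} := ⟨huT, huc⟩
    exact Set.mem_iUnion.2 ⟨k, x, hx, u, huB, hk⟩
  by_cases hneg : 1 - 2 * δ < 0
  · exact ⟨0, fun n _ => hneg.trans_le measureReal_nonneg⟩
  rw [not_lt] at hneg
  have hge : ENNReal.ofReal (1 - 2 * δ) < μ (⋃ n, U n) := by
    rw [ENNReal.ofReal_lt_iff_lt_toReal hneg (measure_ne_top _ _)]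
    have h1 : (μ (TwoAxis.SeedPerc (↑SEED : Set V))).toReal ≤ (μ (⋃ n, U n)).toReal :=
      ENNReal.toReal_mono (measure_ne_top _ _) (measure_mono_ae hcover)
    rw [measureReal_def] at hseed
    linarith
  obtain ⟨n₁, hn₁⟩ := (hUlim.eventually (lt_mem_nhds hge)).exists_forall_of_atTop
  refine ⟨n₁, fun n hn => ?_⟩
  rw [measureReal_def]
  exact (ENNReal.ofReal_lt_iff_lt_toReal hneg (measure_ne_top _ _)).1 (hn₁ n hn)

/-- **(L3, right anchor)**: `P(SEED ↔ {α = M+1} inside [−2n+M+1, M+1]) > 1 − 2δ` for all large `n` (mirror image of the left anchor).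
[cite: MartineauTassion2017, §3.2 Fact 2] -/
theorem eventually_evLine_rightAnchor [Countable V] {types : Finset V} (hc : G.Preconnected) (hfr : Frames G φ types) (hstep : Steps G φ) (hlip : Lip G φ)
    {p : unitInterval} (hU : ∀ᵐ ω ∂bondPercolation G p, numInfiniteClusters ω ≤ 1) {M : ℕ} (SEED : Finset V)
    (hSM : ∀ x ∈ SEED, |relCoord φ t 0 x| ≤ M) {δ : ℝ} (hδ0 : 0 < δ) (hseed : 1 - δ ≤ (bondPercolation G p).real (TwoAxis.SeedPerc (↑SEED : Set V))) :
    ∃ n₁ : ℕ, ∀ n : ℕ, n₁ ≤ n → 1 - 2 * δ < (bondPercolation G p).real (evLine φ t ↑SEED (-(2 * (n : ℤ)) + M + 1) ((M : ℤ) + 1) ((M : ℤ) + 1)) := by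
  set μ := bondPercolation G p with hμ
  set U : ℕ → Set (BondConfig V) := fun n => evLine φ t ↑SEED (-(2 * (n : ℤ)) + M + 1) ((M : ℤ) + 1) ((M : ℤ) + 1) with hUdef
  have hUmono : Monotone U := by
    intro n n' hnn'
    refine openCrossing_mono (fun w hw => ⟨?_, hw.2⟩) le_rfl (fun w hw => ⟨⟨?_, hw.1.2⟩, hw.2⟩)
    · have := hw.1; omega
    · have := hw.1.1; omega
  have hUlim : Tendsto (fun n => μ (U n)) atTop (𝓝 (μ (⋃ n, U n))) := tendsto_measure_iUnion_atTop hUmono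
  have hQ : MeetsAS G p (halfPlane φ t 0 1 ((M : ℤ) + 2)) :=
    Skelφ.meetsAS_of_farBoxes hc hfr hstep hlip t hU (farBoxes_halfPlane t 0 1 ((M : ℤ) + 2))
  have hae : ∀ᵐ ω ∂μ, ω ⊆ G.edgeSet := setBernoulli_ae_subset
  have hcover : ∀ᵐ ω ∂μ, ω ∈ TwoAxis.SeedPerc (↑SEED : Set V) → ω ∈ ⋃ n, U n := by
    filter_upwards [hae, hQ] with ω hω hωQ hin
    obtain ⟨x, hx, hperc⟩ := hin
    obtain ⟨y, hyQ, hreach⟩ := hωQ x hperc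
    have hxM := abs_le.1 (hSM x (Finset.mem_coe.1 hx))
    have hxS : x ∈ {w : V | relCoord φ t 0 w ≤ M} := hxM.2
    have hyS : y ∉ {w : V | relCoord φ t 0 w ≤ M} := by
      intro h'
      rw [mem_halfPlane, Units.val_one, one_mul] at hyQ
      have h'' : relCoord φ t 0 y ≤ M := h'
      omega
    obtain ⟨z, hz, u, -, huS, hzu, hxz⟩ :=
      TwoAxis.exists_exit_of_openConnIn (S := {w : V | relCoord φ t 0 w ≤ M}) hxS hyS (openConnIn_univ_of_reachable hreach)
    have hadj : G.Adj z u := hω ((openGraph_adj ω z u).1 hzu).1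
    have h1 := abs_le.1 (abs_relCoord_sub_le_one (t := t) hlip hadj)
    have hz' : relCoord φ t 0 z ≤ M := hz
    have huS' : ¬ (relCoord φ t 0 u ≤ M) := huS
    have huc : relCoord φ t 0 u = (M : ℤ) + 1 := by omega
    have hTmono : Monotone (fun n : ℕ => slabS φ t (-(2 * (n : ℤ)) + M + 1) ((M : ℤ) + 1)) := by
      intro n n' hnn' w hw
      exact ⟨by have := hw.1; omega, hw.2⟩
    have hHT : {w : V | relCoord φ t 0 w ≤ (M : ℤ) + 1} ⊆ ⋃ n : ℕ, slabS φ t (-(2 * (n : ℤ)) + M + 1) ((M : ℤ) + 1) := by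
      intro w hw
      have hw' : relCoord φ t 0 w ≤ (M : ℤ) + 1 := hw
      refine Set.mem_iUnion.2 ⟨((M : ℤ) + 1 - relCoord φ t 0 w).toNat, ⟨?_, hw'⟩⟩
      have := Int.self_le_toNat ((M : ℤ) + 1 - relCoord φ t 0 w)
      omega
    have hsub : {w : V | relCoord φ t 0 w ≤ M} ⊆ {w : V | relCoord φ t 0 w ≤ (M : ℤ) + 1} := by
      intro w hw
      have hw' : relCoord φ t 0 w ≤ M := hw
      show relCoord φ t 0 w ≤ (M : ℤ) + 1
      omega
    have huH : u ∈ {w : V | relCoord φ t 0 w ≤ (M : ℤ) + 1} := by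
      show relCoord φ t 0 u ≤ (M : ℤ) + 1
      omega
    have hpath : ω ∈ openConnIn (⋃ n : ℕ, slabS φ t (-(2 * (n : ℤ)) + M + 1) ((M : ℤ) + 1)) x u :=
      openConnIn_mono hHT x u (openConnIn_snoc (openConnIn_mono hsub x z hxz) huH hzu)
    obtain ⟨k, hk⟩ := exists_openConnIn_of_iUnion hTmono hpath
    obtain ⟨-, huT, -⟩ := id hk
    have huB : u ∈ {w | w ∈ slabS φ t (-(2 * (k : ℤ)) + M + 1) ((M : ℤ) + 1) ∧ relCoord φ t 0 w = (M : ℤ) + 1} := ⟨huT, huc⟩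
    exact Set.mem_iUnion.2 ⟨k, x, hx, u, huB, hk⟩
  by_cases hneg : 1 - 2 * δ < 0
  · exact ⟨0, fun n _ => hneg.trans_le measureReal_nonneg⟩
  rw [not_lt] at hneg
  have hge : ENNReal.ofReal (1 - 2 * δ) < μ (⋃ n, U n) := by
    rw [ENNReal.ofReal_lt_iff_lt_toReal hneg (measure_ne_top _ _)]
    have h1 : (μ (TwoAxis.SeedPerc (↑SEED : Set V))).toReal ≤ (μ (⋃ n, U n)).toReal :=
      ENNReal.toReal_mono (measure_ne_top _ _) (measure_mono_ae hcover)
    rw [measureReal_def] at hseed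
    linarith
  obtain ⟨n₁, hn₁⟩ := (hUlim.eventually (lt_mem_nhds hge)).exists_forall_of_atTop
  refine ⟨n₁, fun n hn => ?_⟩
  rw [measureReal_def]
  exact (ENNReal.ofReal_lt_iff_lt_toReal hneg (measure_ne_top _ _)).1 (hn₁ n hn)

end Eq

end Skelφ

end Summit.CriticalPhenomena.PercolationContinuityZ3.Theorems.Transplant

end
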